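import Summits.Ventures.QEC.Census.FoldFiber
import HarnessLib

/-!
# Fold enumeration — fibre completeness (the main reconstruction theorem)

Continuation of `Census/FoldFiber.lean`: `Geo.fiber_complete`.
-/

namespace Summit.Ventures.QEC.Census.Fold

open Summit.Ventures.QEC.Census

namespace Geo

variable {G : Geo}

/-- **FIBRE COMPLETENESS.**  Under the index facts `G.OK`: if the enumerator (with correct column
tables `M = fcol`, `Mp = pcol` on the small window) succeeds on the support of `t`, every big kernel word
of weight `≤ W` whose fold is `t` is (the word of) one of its outputs. -/
theorem fiber_complete (hG : G.OK) {C : TCode} {M Mp : ℕ → ℕ} (hM : ∀ j, j < G.ns → M j = fcol G C j)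
    (hMp : ∀ j, j < G.ns → Mp j = pcol G C j) {W t : ℕ} (ht : t < 2 ^ G.ns) {out : List (List ℕ)}
    (hout : fiber G M Mp W (bitsOf G.ns 0 t) = some out) {u : ℕ} (hu : u < 2 ^ G.n) (hker : C.ker G.n u)
    (hwt : popc G.n u ≤ W) (hfold : G.foldW u = t) :
    ∃ S ∈ out, maskOf S = u ∧ (∀ J ∈ S, J < G.n) ∧ S.length = popc G.n u := by
  -- names
  set P := bitsOf G.ns 0 t with hPdef
  set a := G.aPart u with ha
  set b := G.bPart u with hb
  have hab : a ^^^ b = t := by rw [ha, hb, ← foldW_eq_parts, hfold]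
  have hbt : b = a ^^^ t := by rw [← hab, ← Nat.xor_assoc, Nat.xor_self, Nat.zero_xor]
  have hPlt : ∀ j ∈ P, j < G.ns := fun j hj => lt_of_mem_bitsOf hj
  have hPmask : maskOf P = t := maskOf_bitsOf_zero _ _ ht
  have hPlen : P.length = popc G.ns t := length_bitsOf _ _ _
  have hPM : P.map M = P.map (fcol G C) := List.map_congr_left fun j hj => hM j (hPlt j hj)
  set O := outsideOf G.ns P with hOdef
  set e := O.filter fun j => (a &&& b).testBit j with hedef
  set x := restrictTo P 0 a with hxdef
  have hPnodup : P.Nodup := hPdef ▸ nodup_bitsOf _ _ _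
  have hOmem : ∀ j, j ∈ O ↔ j < G.ns ∧ j ∉ P := fun j => by
    rw [hOdef, outsideOf, mem_bitsOf_zero_iff, Nat.testBit_xor, Nat.testBit_two_pow_sub_one,
      testBit_maskOf_nodup P hPnodup]
    by_cases hj : j < G.ns <;> by_cases hp : j ∈ P <;> simp [hj, hp]
  have hOlt : ∀ j ∈ O, j < G.ns := fun j hj => ((hOmem j).1 hj).1
  have helt : ∀ j ∈ e, j < G.ns := fun j hj => hOlt j (List.mem_of_mem_filter hj)
  have heM : xorIdx M e = xorIdx (fcol G C) e := xorIdx_congr fun j hj => hM j (helt j hj)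
  have hfr : frhs Mp P = lin (fun j => C.col (G.partner (G.emb j))) G.ns 0 t := by
    rw [frhs, xorIdx_congr (h := pcol G C) (fun j hj => hMp j (hPlt j hj)), xorIdx_eq_lin _ _ _ hPlt, hPmask]; rfl
  -- mask of e = a ∧ b
  have hOnodup : O.Nodup := hOdef ▸ nodup_bitsOf _ _ _
  have hemask : maskOf e = a &&& b := by
    rw [hedef, maskOf_filter_testBit]
    apply Nat.eq_of_testBit_eq; intro i
    rw [Nat.testBit_and, testBit_maskOf_nodup O hOnodup]
    rcases hbit : (a &&& b).testBit i with _ | _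
    · simp
    · simp only [Bool.true_and, decide_eq_true_eq, hOmem]
      rw [Nat.testBit_and, Bool.and_eq_true] at hbit
      refine ⟨?_, ?_⟩
      · by_contra hi
        rw [not_lt] at hi
        have := Nat.testBit_lt_two_pow (lt_of_lt_of_le (aPart_lt hG u) (Nat.pow_le_pow_right (by norm_num) hi))
        rw [← ha] at this; rw [this] at hbit; exact Bool.false_ne_true hbit.1
      · have hti : t.testBit i = false := by
          rw [← hab, Nat.testBit_xor, hbit.1, hbit.2]; rfl
        rw [hPdef, mem_bitsOf_zero_iff, hti]; simp
  -- budget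
  have hlen : e.length ≤ (W - P.length) / 2 := by
    have hcard : e.length = popc G.ns (a &&& b) := by
      rw [popc_eq_card, hedef, ← List.toFinset_card_of_nodup (hOnodup.filter _), List.toFinset_filter]
      congr 1
      ext i
      simp only [Finset.mem_filter, Finset.mem_range, List.mem_toFinset, hOmem]
      constructor
      · rintro ⟨⟨hi, -⟩, hb'⟩; exact ⟨hi, hb'⟩
      · rintro ⟨hi, hb'⟩
        refine ⟨⟨hi, ?_⟩, hb'⟩
        rw [hPdef, mem_bitsOf_zero_iff, ← hab, Nat.testBit_xor]
        rw [Nat.testBit_and, Bool.and_eq_true] at hb'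
        rw [hb'.1, hb'.2]; simp
    have hw : popc G.n u = popc G.ns t + 2 * popc G.ns (a &&& b) := by
      rw [popc_eq_parts hG hu, ← ha, ← hb, ← popc_xor_add, hab]
    rw [hcard, hPlen]; omega
  -- the linear system
  have hsys : selXor (P.map M) x = frhs Mp P ^^^ xorIdx M e := by
    have h0 : lin C.col G.n 0 u = 0 := hker
    rw [recon hG hu, lin_xor, lin_col_embW hG, lin_col_parW hG, ← ha, ← hb, hbt, lin_xor] at h0
    have hf : lin (fun j => C.col (G.emb j)) G.ns 0 a ^^^ lin (fun j => C.col (G.partner (G.emb j))) G.ns 0 a =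
        lin (fcol G C) G.ns 0 a := by rw [← lin_xor_fun]; rfl
    have ha2 : lin (fcol G C) G.ns 0 a = xorIdx M e ^^^ selXor (P.map M) x := by
      conv_lhs => rw [← and_xor_self_decomp a b, hab, lin_xor]
      rw [heM, hPM, xorIdx_eq_lin _ _ _ helt, hemask, selXor_map_eq_lin _ _ _ hPlt, hxdef, selP_restrictTo, hPmask]
    rw [← Nat.xor_assoc, hf, ← hfr, ha2] at h0
    exact xor_eq_of_xor_xor_eq_zero h0
  -- the solver lists x, and the leaf is not pruned
  have hpiv := pivOKcore_of_fiber G M Mp W P hout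
  have hxlt : x < 2 ^ (P.map M).length := by
    rw [List.length_map, hxdef]; have := restrictTo_lt P 0 a; rwa [Nat.zero_add] at this
  have hxsol : x ∈ (gaussPiv (P.map M)).solutions (P.map M) (frhs Mp P ^^^ xorIdx M e) := by
    have := solutions_complete hpiv x
    rwa [Nat.mod_eq_of_lt hxlt, hsys] at this
  have hred : 2 ≤ (W - P.length) / 2 → (gaussPiv (P.map M)).red (frhs Mp P ^^^ xorIdx M e) = 0 := fun hs => by
    rw [← hsys]; exact red_selXor (pivOK_of_fiber G M Mp W P hout hs) x
  -- hence the word is produced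
  have herev : ∀ j ∈ e.reverse, j < G.ns := fun j hj => helt j (List.mem_reverse.1 hj)
  refine ⟨mkWord G P e.reverse x, mem_fiber_of_solution G M Mp W P hout e (List.filter_sublist) hlen hred x hxsol, ?_,
    mkWord_bound hG P e.reverse hPlt herev x, ?_⟩
  · have h1 : (a &&& b) ^^^ (a &&& t) = a := by rw [← hab]; exact and_xor_self_decomp a b
    have h2 : (a &&& b) ^^^ (t ^^^ (a &&& t)) = b := by
      rw [Nat.xor_left_comm, h1, hbt, Nat.xor_comm]
    rw [maskOf_mkWord P e.reverse hPlt herev, maskOf_reverse, hemask, hxdef, selP_restrictTo, hPmask, h1, h2]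
    exact (recon hG hu).symm
  · rw [length_mkWord, List.length_reverse]
    have hcard : e.length = popc G.ns (a &&& b) := by
      rw [popc_eq_card, hedef, ← List.toFinset_card_of_nodup (hOnodup.filter _), List.toFinset_filter]
      congr 1
      ext i
      simp only [Finset.mem_filter, Finset.mem_range, List.mem_toFinset, hOmem]
      constructor
      · rintro ⟨⟨hi, -⟩, hb'⟩; exact ⟨hi, hb'⟩
      · rintro ⟨hi, hb'⟩
        refine ⟨⟨hi, ?_⟩, hb'⟩
        rw [hPdef, mem_bitsOf_zero_iff, ← hab, Nat.testBit_xor]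
        rw [Nat.testBit_and, Bool.and_eq_true] at hb'
        rw [hb'.1, hb'.2]; simp
    have hw : popc G.n u = popc G.ns t + 2 * popc G.ns (a &&& b) := by
      rw [popc_eq_parts hG hu, ← ha, ← hb, ← popc_xor_add, hab]
    rw [hw, hcard, hPlen]; ring

end Geo

end Summit.Ventures.QEC.Census.Fold
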